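import Summits.CriticalPhenomena.CardyFormulaZ2.Theses.CardyBoundaryCoulombGas
import Summits.CriticalPhenomena.CardyFormulaZ2.Theorems.HalfPlaneOneArmThird.Negative.EventForms
import Literature.Probability.Percolation.IkhlefPonsaingFirstPassage
import Literature.MathematicalPhysics.QuantumLattice.SpinSystem
import Literature.MathematicalPhysics.QuantumLattice.SpinOperators

/-!
# Line `boundary-field-response` for crux `CardyBoundaryCoulombGas.HalfPlaneOneArmThird`
(stmt-CriticalPhenomena-5662; shared verbatim with `CardyTotalPositivity.HalfPlaneOneArmThird`)

Skeleton (crux-plan, planner-cruxplan-stmt-CriticalPhenomena-5662-boundary-field-respo-0, 2026-08-16) of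
crux idea `Cruxes/HalfPlaneOneArmThird/Ideas/boundary-field-response.md` (crux-ideate r1, ideator 3;
triage r1-1 / r1-2 / r1-3: pass ×3, with the mandatory sign/branch correction built in).

THE CRUX. `log P_{1/2}[0 ↔ ∂([-n,n]×[0,n]) inside the half-box] / log n → -1/3`: the half-plane one-arm
exponent `β₁⁺` of bond percolation on `ℤ²` at `p = 1/2` exists and equals `1/3`
(= `Negative.ExponentAt half (1/3)`, `Negative.crux_iff`).

THE LINE (energies, not eigenvectors). Let `H(h₁,h_L) = Σ_{j<L-1} [σˣⱼσˣⱼ₊₁ + σʸⱼσʸⱼ₊₁ − ½ σᶻⱼσᶻⱼ₊₁]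
− h₁ σᶻ_first + h_L σᶻ_last` be the open XXZ chain at `Δ = −1/2` with DIAGONAL boundary fields
(Sklyanin-integrable for all complex `h₁, h_L`; Alcaraz–Barber–Batchelor–Baxter–Quispel 1987), of odd
length `L = 2m+1`, and `h⋆ = i√3/2` the `U_q(sl₂)`-invariant point `q = e^{2πi/3}` (Pasquier–Saleur 1990;
Ikhlef–Ponsaing 2012 eq. (HXXZ)). Restricted to the sector `S^z = +1/2` (`m+1` up spins),
`H⋆ = H(h⋆,h⋆)` has the eigenvalue `E⋆ = 3m = 3(L−1)/2` — the STOCHASTIC branch (top of the printed real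
spectrum = ground state of the Temperley–Lieb(n=1) Hamiltonian `Σ(1 − e_j)`, de Gier–Nichols–Pyatov–
Rittenberg 2005 §3.1), which is SIMPLE there (`stub_simpleTop`; exact for L = 3,5,7,9, this seat).
* (IP) `stub_passage_eq_spin` — Ikhlef–Ponsaing 2012 Prop. 5.5 in biorthogonal form: the wall passage
  probability `P_b(L)` of the diagonal percolation strip (the literal event of the tree fact
  `IkhlefPonsaingFirstPassage`) equals `Re ⟨u|σᶻ_first|v⟩/⟨u|v⟩` for the left/right eigenvectors of `H⋆`
  at `E⋆` in that sector. CHECKED EXACTLY over `ℚ(√−3)` at L = 3, 5, 7, 9: `3/4, 78/121, 247/425, 210/391`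
  (compute/hf_exact.py on the item; the literal lowest eigenvalue of the printed `H` is a self-orthogonal
  Jordan branch where nothing holds — triage r1-1/r1-3 — hence the branch `E⋆ = 3m` is named explicitly).
* (HF) `stub_hellmannFeynman` — generic finite-dimensional Hellmann–Feynman/Jacobi at a SIMPLE eigenvalue
  `z` of a complex matrix `A`: a biorthogonal eigenpair with `⟨u|v⟩ ≠ 0` exists, every biorthogonal
  expectation `⟨u|B|v⟩/⟨u|v⟩` equals the choice-free `jacobiResponse A B z = tr(adj(z − A)·B)/p′_A(z)`, and
  the eigenvalue branch `E(t)` of the pencil `A + tB` through `z` is differentiable at `0` with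
  `E′(0) = jacobiResponse A B z` (implicit function theorem on `det(w − A − tB)`). Provable now.
  Consequence (proved below, `wallPassage_eq_re_energyResponse`): `P_b(2m+1) = Re R(m)` with
  `R(m) := energyResponse m = jacobiResponse H⋆ σᶻ_first (3m) = −∂E/∂h₁(h⋆) = ⟨σᶻ_first⟩`.
* (E) `stub_energyResponseExponent` — THE ENGINE (C⁺_E of the card, hardest, open): `log Re R(m) /
  log(2m+1) → −1/3`, i.e. `−Re ∂_{h₁}E = L^{-1/3+o(1)}`: the boundary crossover exponent `y = 2/3`
  (`β₁⁺ = 1 − y`) of the one relevant boundary perturbation `σᶻ_first ~ φ_{1,3}` of the free boundary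
  condition at `c = 0`, to be read from the Bethe equations of `H(h₁,h⋆)` in ONE boundary parameter
  (ground-state energy of the one-defect sector only; no excited sectors, no eigenvectors). By (IP)+(HF) and
  IP Props 4.7/4.9 (`P_b = A_V(L)A_V(L+2)/N_8(L+1)² ∼ 1.137·L^{-1/3}`) the statement is TRUE if IP's qKZ
  computation is; the line's bet is an eigenvalue-side proof (Yang–Yang / NLIE technology).
* (D) `stub_wallDictionary` — matched-scale RSW dictionary: `c·diagArm n ≤ P_b(2n+1) ≤ diagArm n`,
  `diagArm n > 0`, where `diagArm n` is the one-arm probability to sup-distance `n` in the DIAGONAL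
  half-plane `{x₀+x₁ ≤ 1}` (exact inclusion one way, one RSW/FKG gluing the other; no ratio limits).
* (O) `stub_orientationTransfer` — `(log diagArm n − log axisArm n)/log n → 0` with `axisArm n =
  Negative.prob half n` the crux probability verbatim: DKKMO 2020 Cor. 1.3 at `q = 1` (tree fact
  `dkkmo_crossing_rotation_invariance`, rotation by `π/4` of half-annulus quads) + one-arm
  quasi-multiplicativity with `λ`-independent RSW/FKG constants (triage F1/[T]: `limsup |…| ≤
  2log(1/c)/log λ` for every `λ`).
* `HalfPlaneOneArmThird_of` — the kernel-checked composition (no `sorry` of its own): (IP)+(HF)+simplicity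
  give `P_b(2n+1) = Re R(n)`; (E) and `log(2n+1)/log n → 1` give `log P_b(2n+1)/log n → −1/3`; (D) squeezes
  `log diagArm n / log n → −1/3`; (O) moves it to the axis half-plane; `Negative.crux_iff` closes.

Disproof.lean (cdisprove, read 2026-08-16) / landed `Theorems/HalfPlaneOneArmThird/Negative/*` (imported here):
no `_false_without_` theorem exists; `crux_false_of_ne_half` (p = 1/2 is load-bearing) is honoured — the
loop weight is `n = 1` (stochastic transfer matrix, `E⋆` = Perron branch) only at the self-dual point, and
(D)/(O) are two-sided RSW statements valid only at `p = 1/2`; `exponentAt_half_window` (`α₀ ≤ β ≤ 1`):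
the value `1/3` produced by (E) is inside; `prob_eq_far`: (O) is stated against `axisArm = Negative.prob half`
itself (`rfl`).
`ledger negatives --problem CriticalPhenomena` (stmt-0748, stmt-6949, …): no stub is an instance.
-/

noncomputable section

namespace Summit.CriticalPhenomena.CardyFormulaZ2.Cruxes.HalfPlaneOneArmThird.BoundaryFieldResponse

open MeasureTheory Filter Topology
open scoped BigOperators
open Literature.Probability.Percolation Literature.Probability.LatticeModels
open Literature.MathematicalPhysics.QuantumLattice (TensorIndex Op onSite spinHalfPauli)
open Summit.CriticalPhenomena.CardyFormulaZ2.Theorems.HalfPlaneOneArmThird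

set_option linter.unusedVariables false

/-! ## Vocabulary — the spin chain -/

/-- The Pauli matrix `σ^α` (`α = 0,1,2` for `x,y,z`; `σᶻ = diag(1,−1)`, so the local state `0 : Fin 2`
is spin UP) acting at site `j` of a chain of `L` spins-½ (tree `onSite`, `spinHalfPauli`). -/
def pauliAt {L : ℕ} (j : Fin L) (α : Fin 3) : Op (Fin L) 2 :=
  onSite j (spinHalfPauli α)

/-- The XXZ bond at anisotropy `Δ = −1/2`: `σˣⱼσˣₖ + σʸⱼσʸₖ − ½ σᶻⱼσᶻₖ`
(Ikhlef–Ponsaing 2012, eq. (HXXZ); `q + q⁻¹ = −1 = 2Δ` at `q = e^{2πi/3}`). -/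
def xxzBond {L : ℕ} (j k : Fin L) : Op (Fin L) 2 :=
  pauliAt j 0 * pauliAt k 0 + pauliAt j 1 * pauliAt k 1 - (1 / 2 : ℂ) • (pauliAt j 2 * pauliAt k 2)

/-- **The open XXZ chain of odd length `L = 2m+1` at `Δ = −1/2` with diagonal boundary fields**
`H(h₁,h_L) = Σ_{j<2m} [σˣⱼσˣⱼ₊₁ + σʸⱼσʸⱼ₊₁ − ½σᶻⱼσᶻⱼ₊₁] − h₁ σᶻ_first + h_L σᶻ_last`
(Sklyanin's integrable family with diagonal `K`-matrices; at `h₁ = h_L = i√3/2` it is the printed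
`U_q(sl₂)`-invariant Hamiltonian of Ikhlef–Ponsaing 2012 §2.4/§5.3.1 = Pasquier–Saleur 1990). -/
def xxzH (m : ℕ) (h₁ hL : ℂ) : Op (Fin (2 * m + 1)) 2 :=
  (∑ j : Fin (2 * m), xxzBond (Fin.castSucc j) (Fin.succ j))
    - h₁ • pauliAt (0 : Fin (2 * m + 1)) 2 + hL • pauliAt (Fin.last (2 * m)) 2

/-- The quantum-group point `h⋆ = i√3/2` (`= −sinh η`, `q = e^{η} = e^{2πi/3}`). -/
def hStar : ℂ := Complex.I * (Real.sqrt 3 : ℂ) / 2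

/-- The sector `S^z = +1/2` of the chain of length `2m+1`: configurations with exactly `m+1` up spins
(local state `0`). `H(h₁,h_L)` commutes with `S^z_tot`, so its restriction to this sector is a block. -/
abbrev Sector (m : ℕ) : Type :=
  {σ : TensorIndex (Fin (2 * m + 1)) 2 // (Finset.univ.filter fun j => σ j = 0).card = m + 1}

/-- The `S^z = +1/2` block of `H(h₁,h_L)`. -/
def xxzSector (m : ℕ) (h₁ hL : ℂ) : Matrix (Sector m) (Sector m) ℂ :=
  (xxzH m h₁ hL).submatrix Subtype.val Subtype.val

/-- The `S^z = +1/2` block of `σᶻ_first` (diagonal, entries `±1`; `−∂H/∂h₁`). -/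
def szFirst (m : ℕ) : Matrix (Sector m) (Sector m) ℂ :=
  (pauliAt (0 : Fin (2 * m + 1)) 2).submatrix Subtype.val Subtype.val

/-- **Jacobi's choice-free form of a Hellmann–Feynman response.** For a square complex matrix `A`, a
perturbation `B` and a simple eigenvalue `z` of `A`:
`jacobiResponse A B z = tr(adj(z·1 − A) · B) / p′_A(z)`, which equals `⟨u|B|v⟩/⟨u|v⟩` for any left/right
eigenvectors `u, v` of `A` at `z` (adj(z − A) = (p′_A(z)/⟨u|v⟩)·|v⟩⟨u|) and equals `E′(0)` for the
eigenvalue branch `E(t)` of `A + tB` through `z` (Jacobi's formula `∂_t det = tr(adj·∂_t)` + implicit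
differentiation of `det(E(t) − A − tB) = 0`). See `stub_hellmannFeynman`. -/
def jacobiResponse {ι : Type*} [Fintype ι] [DecidableEq ι] (A B : Matrix ι ι ℂ) (z : ℂ) : ℂ :=
  ((z • (1 : Matrix ι ι ℂ) - A).adjugate * B).trace / (A.charpoly.derivative.eval z)

/-- **The boundary-field ENERGY RESPONSE** of the chain of length `2m+1` at the quantum-group point:
`R(m) = jacobiResponse H⋆ σᶻ_first (3m) = ⟨σᶻ_first⟩_biorth = −∂E/∂h₁ |_{h₁ = h_L = h⋆}` for the
stochastic branch `E`, `E(h⋆) = 3m`, of the `S^z = +1/2` block of `H(h₁, h⋆)` (by `stub_hellmannFeynman`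
with `A = H⋆`, `B = σᶻ_first`, since `H(h₁,h⋆) = H⋆ − (h₁ − h⋆)σᶻ_first`). Exactly (this seat, `ℚ(√−3)`):
`R(1) = 3/4 − (√3/4)i`, `R(2) = 78/121 − (43√3/121)i`, `R(3) = 247/425 − (178√3/425)i`,
`R(4) = 210/391 − (181√3/391)i` — real parts = Ikhlef–Ponsaing's `P_b(3), P_b(5), P_b(7), P_b(9)`. -/
def energyResponse (m : ℕ) : ℂ :=
  jacobiResponse (xxzSector m hStar hStar) (szFirst m) ((3 * m : ℕ) : ℂ)

/-! ## Vocabulary — percolation -/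

/-- **Wall passage probability `P_b(2m+1)`**: for bond percolation on `ℤ²` at `p = 1/2`, the site
`b = (2m, 0)` of level `x₀+x₁ = 2m` (one unit inside the free face `x₀+x₁ = 2m+1`) is joined to some wall
site `w`, `w₀+w₁ = 0`, by an open path inside the diagonal strip `{0 ≤ x₀+x₁ ≤ 2m+1}` — VERBATIM the
event of the tree fact `Literature.Probability.Percolation.IkhlefPonsaingFirstPassage` at this `b`
i.e. Ikhlef–Ponsaing's first-site passage probability of the
infinite hull (their Def. 4.1 / Prop. 4.7: `1, 3/4, 78/121, 247/425, 210/391, …`); see the checked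
`example` below the percolation vocabulary. -/
def wallPassage (m : ℕ) : ℝ :=
  (bondPercolation (zdGraph 2) half).real
    {ω | ∃ w : Site 2, w 0 + w 1 = 0 ∧
      ω ∈ openConnIn {x : Site 2 | 0 ≤ x 0 + x 1 ∧ x 0 + x 1 ≤ ((2 * m + 1 : ℕ) : ℤ)}
        ![2 * (m : ℤ), 0] w}

/-- **Diagonal half-plane one-arm probability `diagArm n`**: `0` is joined, inside the diagonal half-plane
`{x₀+x₁ ≤ 1}` (free boundary line `x₀+x₁ = 1`, the origin one unit inside — exactly the position of `b`
relative to the free face) cut to the box `[-n,n]²`, to a site of the box boundary `{|y₀| = n} ∪ {|y₁| = n}`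
(= ideator 3's `diagArmBelow`). -/
def diagArm (n : ℕ) : ℝ :=
  (bondPercolation (zdGraph 2) half).real
    {ω | ∃ y : Site 2, (y 0 = (n : ℤ) ∨ y 0 = -(n : ℤ) ∨ y 1 = (n : ℤ) ∨ y 1 = -(n : ℤ)) ∧
      ω ∈ openConnIn {v : Site 2 | v 0 + v 1 ≤ 1 ∧ -(n : ℤ) ≤ v 0 ∧ v 0 ≤ n ∧ -(n : ℤ) ≤ v 1 ∧ v 1 ≤ n}
        0 y}

/-- **Axis half-plane one-arm probability `axisArm n`** — VERBATIM the probability in the crux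
`HalfPlaneOneArmThird`: `0` is joined inside the half-box `[-n,n]×[0,n]` to its outer boundary
`{y₀ = ±n} ∪ {y₁ = n}` (= the landed `Negative.prob half n`, `axisArm_eq_prob`, `rfl`). -/
def axisArm (n : ℕ) : ℝ :=
  (bondPercolation (zdGraph 2) half).real
    {ω | ∃ y : Site 2, (y 0 = (n : ℤ) ∨ y 0 = -(n : ℤ) ∨ y 1 = (n : ℤ)) ∧
      ω ∈ openConnIn {v : Site 2 | 0 ≤ v 1 ∧ -(n : ℤ) ≤ v 0 ∧ v 0 ≤ n ∧ v 1 ≤ n} 0 y}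

/-- `axisArm` is the landed disprover's `Negative.prob half` (and the crux is `Negative.ExponentAt half (1/3)`,
`Negative.crux_iff`), definitionally. -/
theorem axisArm_eq_prob (n : ℕ) : axisArm n = Negative.prob half n := rfl

/- Dictionary anchor (checked `example`, deliberately not a named lemma of the line): the wall passage
event is literally the event of the tree fact `IkhlefPonsaingFirstPassage` (IP12 Prop. 4.7) at `b = (2m, 0)`,
so under that fact `wallPassage m = A_V(2m+1) A_V(2m+3) / N_8(2m+2)²` (`= ipRatio m` of crux
`EdgePrecompact`'s line `qkz-strip-boundary-arm`). The line itself needs only the EXPONENT of `P_b`, which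
it takes from the energy side; provers of `stub_passage_eq_spin` and of `stub_ipExact` share this event. -/
example (h : IkhlefPonsaingFirstPassage) (m : ℕ) :
    wallPassage m =
      (∏ i ∈ Finset.range m,
          ((3 * i + 2 : ℕ) * (6 * i + 3).factorial * (2 * i + 1).factorial : ℝ) /
            ((4 * i + 2).factorial * (4 * i + 3).factorial : ℝ)) *
        (∏ i ∈ Finset.range (m + 1),
          ((3 * i + 2 : ℕ) * (6 * i + 3).factorial * (2 * i + 1).factorial : ℝ) /
            ((4 * i + 2).factorial * (4 * i + 3).factorial : ℝ)) /
      (∏ i ∈ Finset.range (m + 1),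
          ((3 * i + 1 : ℕ) * (6 * i).factorial * (2 * i).factorial : ℝ) /
            ((4 * i).factorial * (4 * i + 1).factorial : ℝ)) ^ 2 :=
  h m ![2 * (m : ℤ), 0] (by simp)

/-! ## The stubs -/

/-- **(S) `stub_simpleTop` — the stochastic branch is a simple eigenvalue (M–L; representation theory of
`TL_{2m+1}(n=1)` on the spin chain).** For every `m ≥ 1`, `E⋆ = 3m` is a SIMPLE root of the characteristic
polynomial of the `S^z = +1/2` block of `H⋆ = H(h⋆,h⋆)`, `h⋆ = i√3/2` (Mathlib `Polynomial.rootMultiplicity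
… = 1`, i.e. a root of `p` and not of `p′`).
Why plausibly true: `H⋆ = 2Σⱼ E′ⱼ − m` with `E′ⱼ` the Temperley–Lieb idempotents at loop weight `1`
(Pasquier–Saleur); the sector is filtered by the standard modules `W_1, W_3, W_5, …` (one copy each); on
`W_1` (one defect) `Σ(E′ⱼ − 1)` is an irreducible intensity matrix in the link basis, so `0` (i.e. `E⋆`) is
its simple Perron eigenvalue, while on `W_d`, `d ≥ 3`, `ΣE′ⱼ` is entrywise non-negative and strictly
sub-stochastic (two defects can be contracted), so its spectral radius is `< 2m` and `E⋆` does not occur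
(de Gier–Nichols–Pyatov–Rittenberg hep-th/0505062 §3.1: `H` is an intensity matrix, ground energy `0`;
Morin-Duchesne–Saint-Aubin for the module structure at `q³ = 1`). CHECKED EXACTLY (this seat,
compute/hf_exact.py over `ℚ(√−3)`): right and left nullity of `H⋆ − 3m` equal `1` and `⟨u|v⟩ ≠ 0` at
`L = 3,5,7,9`; `p′(3m) = 16, 6195200, 4.89·10³⁰ ≠ 0` at `L = 3,5,7`. Why it might fail: an accidental
inter-module degeneracy at the root of unity `q³ = 1` putting a `W_d` (`d ≥ 3`) eigenvalue exactly at `3m`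
— excluded by the sub-stochastic bound if irreducibility holds for every `m`. Cheapest falsifier: exact
nullity/`⟨u|v⟩` at `L = 11, 13` (kit j011082 reports the numerical simplicity margin for `L ≤ 15`). -/
theorem stub_simpleTop : ∀ m : ℕ, 1 ≤ m →
    (xxzSector m hStar hStar).charpoly.rootMultiplicity ((3 * m : ℕ) : ℂ) = 1 := by
  sorry

/-- **(IP) `stub_passage_eq_spin` — Ikhlef–Ponsaing's Proposition 5.5, biorthogonal form (XL but
published; THE BRIDGE of the line).** For `m ≥ 1`, if `3m` is a simple root of the characteristic polynomial
of the `S^z = +1/2` block `H⋆` (so that its left/right eigenvectors are unique up to scale), then for every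
left eigenvector `u` and right eigenvector `v` of `H⋆` at `3m` with `⟨u|v⟩ ≠ 0`:
`P_b(2m+1) = wallPassage m = Re (⟨u|σᶻ_first|v⟩ / ⟨u|v⟩)`.
Why plausibly true: Ikhlef–Ponsaing, J. Stat. Phys. 149 (2012) 10 (arXiv:1202.5476), Prop. 5.5 p. 12:
`P_{j+1/2} = Σ_{ℓ≤j} Re ⟨Ψ₀|σᶻ_ℓ|Ψ₀⟩/⟨Ψ₀|Ψ₀⟩` for the biorthogonal ("lowest-energy" in the `t_{6V}` sign
convention = the stochastic branch `E⋆ = 3(L−1)/2` of the printed `H`) eigenvectors, proved there by Baxter's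
loop-orientation trick in the six-vertex representation of the `TL(n=1)` strip transfer matrix (§5.3.2),
with `j = 0` our first site; the percolation side is the configuration-wise dictionary of their §2.1–2.2/§4
(the same event as the tree fact `IkhlefPonsaingFirstPassage`, checked by the `example` above).
VERIFIED EXACTLY by this seat at `L = 3,5,7,9`: `Re = 3/4, 78/121, 247/425, 210/391 = P_b` (and
floating-point to `1e-16` by triage r1-1/r1-3, who located the branch/sector/sign: the literal bottom of
the printed spectrum is a self-orthogonal Jordan branch; the `S^z = −1/2` sector flips the sign).
Why it might fail: only through a hidden assumption in IP's identification "transfer-matrix Perron vector =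
spin-chain eigenvector at `E⋆`" at the root of unity (Jordan blocks elsewhere in the spectrum) — the
simplicity hypothesis is exactly what makes the biorthogonal expectation well defined. Size: L–XL (the
`TL → XXZ` representation on `(ℂ²)^{⊗L}` incl. the boundary phases, the stochastic link-pattern chain and its
stationary vector, Prop. 5.5's orientation argument, the strip ↔ `ℤ²` dictionary). -/
theorem stub_passage_eq_spin : ∀ m : ℕ, 1 ≤ m →
    (xxzSector m hStar hStar).charpoly.rootMultiplicity ((3 * m : ℕ) : ℂ) = 1 →
    ∀ u v : Sector m → ℂ,
      Matrix.vecMul u (xxzSector m hStar hStar) = ((3 * m : ℕ) : ℂ) • u →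
      (xxzSector m hStar hStar).mulVec v = ((3 * m : ℕ) : ℂ) • v →
      u ⬝ᵥ v ≠ 0 →
      wallPassage m = (u ⬝ᵥ (szFirst m).mulVec v / (u ⬝ᵥ v)).re := by
  sorry

/-- **(HF) `stub_hellmannFeynman` — Hellmann–Feynman / Jacobi at a simple eigenvalue (M–L, provable now;
pure finite-dimensional linear algebra + the implicit function theorem).** Let `A, B` be square complex
matrices and `z` a simple root of `p_A = charpoly A` (`rootMultiplicity z p_A = 1`). Then
(a) there are a left eigenvector `u` (`uA = zu`) and a right eigenvector `v` (`Av = zv`) with `⟨u|v⟩ ≠ 0`;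
(b) for EVERY such pair, `⟨u|B|v⟩/⟨u|v⟩ = jacobiResponse A B z = tr(adj(z·1 − A)·B)/p′_A(z)`
    (rank-one adjugate: `adj(z − A) = (p′_A(z)/⟨u|v⟩) · v uᵀ`, from `(z−A)·adj = adj·(z−A) = p_A(z) = 0`,
    `rank(z − A) = n − 1`, and Jacobi `p′_A(z) = tr adj(z − A)`);
(c) the eigenvalue of the pencil `A + tB` near `z` is an honest differentiable BRANCH: there are `ε > 0` and
    `E : ℂ → ℂ` with `E 0 = z`, `E′(0) = jacobiResponse A B z`, and for `‖t‖ < ε`, `E t` is a root of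
    `charpoly (A + tB)` and the only one within `ε` of `z` (implicit function theorem for
    `(t,w) ↦ det(w − A − tB)`, `∂_w = p′_A(z) ≠ 0`, `∂_t = −tr(adj(z−A)B)`).
In the line: `A = H⋆` (sector block), `B = σᶻ_first`, `z = 3m`; since `H(h₁,h⋆) = H⋆ − (h₁−h⋆)σᶻ_first`,
(c) says `energyResponse m = −∂E/∂h₁(h⋆)` — the identity that lets a Bethe-ansatz computation of the
ground-state ENERGY `E(L; h₁, h⋆)` (stub (E)) replace IP's eigenvector. Numerically (triage r1-1/r1-3, kit
j011082): symmetric difference quotients of the branch match `⟨σᶻ_first⟩_biorth` to `1e-8`.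
Why it might fail: it cannot (textbook; Kato, Perturbation theory, II §1–2); the work is Mathlib plumbing
(`Matrix.adjugate`, `Matrix.charpoly`, `eval_charpoly`, `HasStrictFDerivAt.implicitFunction`). -/
theorem stub_hellmannFeynman : ∀ {ι : Type} [Fintype ι] [DecidableEq ι] (A B : Matrix ι ι ℂ) (z : ℂ),
    A.charpoly.rootMultiplicity z = 1 →
    (∃ u v : ι → ℂ, Matrix.vecMul u A = z • u ∧ A.mulVec v = z • v ∧ u ⬝ᵥ v ≠ 0) ∧
    (∀ u v : ι → ℂ, Matrix.vecMul u A = z • u → A.mulVec v = z • v → u ⬝ᵥ v ≠ 0 →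
        u ⬝ᵥ B.mulVec v / (u ⬝ᵥ v) = jacobiResponse A B z) ∧
    (∃ ε : ℝ, 0 < ε ∧ ∃ E : ℂ → ℂ, E 0 = z ∧ HasDerivAt E (jacobiResponse A B z) 0 ∧
        ∀ t : ℂ, ‖t‖ < ε → (A + t • B).charpoly.IsRoot (E t) ∧
          ∀ w : ℂ, (A + t • B).charpoly.IsRoot w → ‖w - z‖ < ε → w = E t) := by
  sorry

/-- **(E) `stub_energyResponseExponent` — THE ENGINE (C⁺_E of the card; HARDEST; open).** The real part
of the boundary-field energy response of the stochastic branch decays with exponent EXACTLY `1/3` in the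
chain length: `log (Re R(m)) / log (2m+1) → −1/3`, `R(m) = energyResponse m = −∂E/∂h₁(h⋆) = ⟨σᶻ_first⟩`.
Why plausibly true: (i) it is TRUE modulo Ikhlef–Ponsaing: by (IP)+(HF)+(S), `Re R(m) = P_b(2m+1)`, and
IP Props 4.7 + 4.9 (qKZ closed form `A_V(L)A_V(L+2)/N_8(L+1)²`, Barnes asymptotics) give
`Re R(m) ∼ 1.137·(2m+1)^{-1/3}` — exact values `L^{1/3} Re R = 1.082, 1.102, 1.112, 1.117` at `L = 3..9`,
local log-slopes `−0.296, −0.308, −0.314, −0.318 → −1/3`; (ii) the line's OWN road, which is the bet: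
`σᶻ_first` at the `U_q` point is the lattice avatar of the one relevant boundary field `φ_{1,3}` (`h = 1/3`)
of the free b.c. at `c = 0`, so `E(L; h⋆+δ) = L e_∞ + f_s(δ) + L^{-1}Φ(δ L^{y}) + …` with boundary
crossover exponent `y = 1 − h = 2/3`, `Re f_s′(0) = 0` (forced: `Re R → 0` by RSW) and `Φ′(0) ≠ 0`, whence
`−Re ∂_δ E = C L^{-1+y} = C L^{-1/3}`; `E` is the ground-state energy of Sklyanin's open chain with
DIAGONAL boundary fields, integrable for all `δ` (Alcaraz–Barber–Batchelor–Baxter–Quispel 1987; Sklyanin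
1988), the object with the most developed rigorous large-`L` technology (root condensation / Yang–Yang
action, Kozlowski arXiv:1508.05741; free energies, Duminil-Copin–Kozlowski–Krachun–Manolescu–Tikhonovskaia
2022; NLIE, arXiv:1811.12020; boundary energy/bound states, LeClair–Mussardo–Saleur–Skorik hep-th/9503227,
Kapustin–Skorik 1996); calibration at `q = 2` (FK-Ising, `Δ = −√2/2`): the same recipe predicts `1/2`, a
theorem (Duminil-Copin–Hongler–Nolin 2011). Why it might fail: the crossover form at a COMPLEX boundary
field `h⋆ + δ` is boundary-CFT lore, and no finite-size Bethe-ansatz template at relative order `L^{-1/3}`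
for an OPEN chain near the point where the boundary factor of the Bethe equations trivialises exists in
print (triage r1-2/r1-3 doubt); `Im R(m)` grows (`−0.433, −0.616, −0.725, −0.802` at `L = 3..9`), so the
`L^{-1/3}` must be isolated in the real part of a derivative whose imaginary part is `O(1)`. If the Bethe road
stalls, the statement still follows from a formalisation of IP Props 4.1–4.9 (shared with line
ip-passage-stirling and with `stub_ipExact`/`stub_ipAsymptotic` of crux `EdgePrecompact`). Cheapest
falsifier: paper computation of the closed-form surface energy `f_s(ξ₋,ξ₊)` of the diagonal-field open XXZ
chain at `Δ = −1/2`, continued to IP's gauge `ξ± = ∓∞`: analyticity in `δ` with `Re f_s′ ≠ 0` would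
contradict `Re R → 0` and kill the eigenvalue road (not the statement). -/
theorem stub_energyResponseExponent :
    Tendsto (fun m : ℕ ↦ Real.log (energyResponse m).re / Real.log (2 * (m : ℝ) + 1)) atTop
      (𝓝 (-(1 / 3 : ℝ))) := by
  sorry

/-- **(D) `stub_wallDictionary` — the matched-scale wall ↔ arm dictionary (L; RSW/FKG at `p = 1/2`,
provable now).** There is `c > 0` such that for every `n ≥ 1`: `diagArm n > 0` and
`c · diagArm n ≤ wallPassage n ≤ diagArm n`.
Why plausibly true: UPPER (exact inclusion, a.s.): translate `b = (2n,0) ↦ 0`; an open path from `0` to the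
wall (level `−2n` after translation) inside the strip `{−2n ≤ x₀+x₁ ≤ 1}` must reach sup-norm `≥ n`
(`|x₀+x₁| ≤ 2‖x‖_∞`); stop it at the FIRST site of sup-norm `n`: the prefix is an open path inside
`{x₀+x₁ ≤ 1} ∩ [−n,n]²` from `0` to the box boundary, i.e. the event of `diagArm n` (the strip's lower
constraint is automatic inside the box) — the first-exit pattern of the landed `Negative.mem_armEvt_of_far` and
of `stub_halfArm_le_strip` (crux `EdgePrecompact`, proved). LOWER (one gluing): given the arm to sup-distance
`n` in the diagonal half-plane, RSW crossings of two tilted rectangles of bounded aspect ratio inside the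
strip `{−2n ≤ x₀+x₁ ≤ 1}` plus an open half-circuit in the tilted half-annulus of radii `n/2, n` (FKG,
`harris_fkg_holds`; crossing bounds from `crossingProb_half_succ_self_holds`-type RSW inscribed in tilted
shapes; paths that cross share a vertex, `exists_mem_support_of_crossing`) connect it to the wall at cost
`≥ c`, uniformly in `n`; positivity: the straight open staircase. Why it might fail: it cannot at the level of
exponents; the only write-up risk is the tilted-RSW bookkeeping (constants for 45°-rotated rectangles from
axis-parallel ones by inscription). Honours `crux_false_of_ne_half`: two-sided RSW is a `p = 1/2` input. -/
theorem stub_wallDictionary : ∃ c : ℝ, 0 < c ∧ ∀ n : ℕ, 1 ≤ n →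
    0 < diagArm n ∧ c * diagArm n ≤ wallPassage n ∧ wallPassage n ≤ diagArm n := by
  sorry

/-- **(O) `stub_orientationTransfer` — diagonal ↔ axis half-plane (L over a vendored 2020 theorem).**
`(log diagArm n − log axisArm n) / log n → 0`, where `axisArm n = Negative.prob half n =
P_{1/2}[0 ↔ ∂([−n,n]×[0,n]) inside the half-box]` is the crux probability VERBATIM (`axisArm_eq_prob`,
`Negative.crux_iff`).
Why plausibly true (triage r1-2 F1 / r1-3 [T], card ip-passage-stirling Transfer (b)): DKKMO
arXiv:2012.11672 Cor. 1.3 at `q = 1` — tree fact `Literature.Probability.Percolation.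
dkkmo_crossing_rotation_invariance` (per quad: for `α ∈ (ε, π−ε)`, `δ < δ₀(Q,ε)`,
`|P[𝒞_δ(e^{iα}Q)] − P[𝒞_δ(Q)]| ≤ ε`) — applied with `α = π/4` to the half-annulus quads
`Q_λ = {1 ≤ |z|_∞ ≤ λ, Im z ≥ 0}` (inner/outer half-squares as marked sides) makes the axis and diagonal
half-annulus crossing probabilities at scale `λ^k` agree to `o(1)`, hence (RSW lower bound `c(λ) > 0`) their
RATIO `→ 1`; one-arm quasi-multiplicativity in either half-plane along `n = λ^k` with `λ`-INDEPENDENT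
constants (`a_{k+1} ≥ a_k b_k c₀²c₁` by two FKG gluings through an open half-circuit and a radial crossing,
`a_{k+1} ≤ C a_k b_k` by independence of disjoint half-annuli) gives
`limsup |log diagArm n − log P_axis n| / log n ≤ 2 log(1/(c₀²c₁)) / log λ` for EVERY `λ > 1`, i.e. `0`;
the local differences at the root (site one unit inside the free line vs on it; box vs half-box target) cost
constants only. Why it might fail: not at all at exponent level (a printed theorem + RSW); write-up risks: the
`λ`-independence of the gluing constants and the passage from DKKMO's continuum quads `𝒞_δ(Q)` to lattice
half-annulus events (RSW continuity of quad crossings in the marked corners). Shared support lemma of every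
diagonal/RS line on this crux (ideator 1's `HalfPlaneRotationExponent`, symmetric form as triage asked). -/
theorem stub_orientationTransfer :
    Tendsto (fun n : ℕ ↦ (Real.log (diagArm n) - Real.log (axisArm n)) / Real.log n) atTop (𝓝 0) := by
  sorry

/-! ## Proved glue -/

/-- **`P_b(2m+1) = Re R(m)`** — the lever of the line, from (S) + (IP) + (HF): the wall passage
probability is the real part of the boundary-field energy response of the stochastic branch. -/
theorem wallPassage_eq_re_energyResponse (m : ℕ) (hm : 1 ≤ m) :
    wallPassage m = (energyResponse m).re := by
  have hs := stub_simpleTop m hm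
  obtain ⟨⟨u, v, hu, hv, huv⟩, hformula, -⟩ :=
    stub_hellmannFeynman (xxzSector m hStar hStar) (szFirst m) ((3 * m : ℕ) : ℂ) hs
  show wallPassage m = (jacobiResponse (xxzSector m hStar hStar) (szFirst m) ((3 * m : ℕ) : ℂ)).re
  rw [stub_passage_eq_spin m hm hs u v hu hv huv, hformula u v hu hv huv]

/-- `log (2n+1) / log n → 1` (squeeze between `1` and `1 + log 3 / log n`). -/
theorem tendsto_log_two_mul_add_one_div_log :
    Tendsto (fun n : ℕ ↦ Real.log (2 * (n : ℝ) + 1) / Real.log n) atTop (𝓝 1) := by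
  have hup : Tendsto (fun n : ℕ ↦ 1 + Real.log 3 / Real.log n) atTop (𝓝 (1 + 0)) :=
    tendsto_const_nhds.add
      (tendsto_const_nhds.div_atTop (Real.tendsto_log_atTop.comp tendsto_natCast_atTop_atTop))
  rw [add_zero] at hup
  refine tendsto_of_tendsto_of_tendsto_of_le_of_le' tendsto_const_nhds hup ?_ ?_
  · filter_upwards [eventually_ge_atTop 2] with n hn
    have hn' : (2 : ℝ) ≤ n := by exact_mod_cast hn
    have hlog : 0 < Real.log n := Real.log_pos (by linarith)
    rw [le_div_iff₀ hlog, one_mul]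
    exact Real.log_le_log (by linarith) (by linarith)
  · filter_upwards [eventually_ge_atTop 2] with n hn
    have hn' : (2 : ℝ) ≤ n := by exact_mod_cast hn
    have hlog : 0 < Real.log n := Real.log_pos (by linarith)
    have h3 : Real.log (2 * (n : ℝ) + 1) ≤ Real.log 3 + Real.log n := by
      rw [← Real.log_mul (by norm_num) (by linarith : (0 : ℝ) < n).ne']
      exact Real.log_le_log (by linarith) (by linarith)
    rw [div_le_iff₀ hlog, add_mul, one_mul, div_mul_cancel₀ _ hlog.ne']
    linarith

/-- **`log P_b(2n+1) / log n → −1/3`** from the engine (E) and the lever. -/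
theorem tendsto_log_wallPassage :
    Tendsto (fun n : ℕ ↦ Real.log (wallPassage n) / Real.log n) atTop (𝓝 (-(1 / 3 : ℝ))) := by
  have h := stub_energyResponseExponent.mul tendsto_log_two_mul_add_one_div_log
  rw [mul_one] at h
  refine h.congr' ?_
  filter_upwards [eventually_ge_atTop 1] with n hn
  have hn' : (1 : ℝ) ≤ n := by exact_mod_cast hn
  have hlog : Real.log (2 * (n : ℝ) + 1) ≠ 0 := (Real.log_pos (by linarith)).ne'
  rw [wallPassage_eq_re_energyResponse n hn, div_mul_div_comm, mul_comm (Real.log (2 * (n : ℝ) + 1)),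
    ← div_mul_div_comm, div_self hlog, mul_one]

/-- **`log diagArm n / log n → −1/3`**: the dictionary (D) squeezes the diagonal half-plane arm between
`P_b(2n+1)` and `P_b(2n+1)/c`. -/
theorem tendsto_log_diagArm :
    Tendsto (fun n : ℕ ↦ Real.log (diagArm n) / Real.log n) atTop (𝓝 (-(1 / 3 : ℝ))) := by
  obtain ⟨c, hc, hdict⟩ := stub_wallDictionary
  have hw := tendsto_log_wallPassage
  have hup : Tendsto (fun n : ℕ ↦ Real.log (wallPassage n) / Real.log n - Real.log c / Real.log n)
      atTop (𝓝 (-(1 / 3 : ℝ) - 0)) :=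
    hw.sub (tendsto_const_nhds.div_atTop (Real.tendsto_log_atTop.comp tendsto_natCast_atTop_atTop))
  rw [sub_zero] at hup
  refine tendsto_of_tendsto_of_tendsto_of_le_of_le' hw hup ?_ ?_
  · filter_upwards [eventually_ge_atTop 2] with n hn
    have hn' : (2 : ℝ) ≤ n := by exact_mod_cast hn
    have hlog : 0 < Real.log n := Real.log_pos (by linarith)
    obtain ⟨hpos, hlo, hhi⟩ := hdict n (by omega)
    have hwpos : 0 < wallPassage n := lt_of_lt_of_le (mul_pos hc hpos) hlo
    exact div_le_div_of_nonneg_right (Real.log_le_log hwpos hhi) hlog.le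
  · filter_upwards [eventually_ge_atTop 2] with n hn
    have hn' : (2 : ℝ) ≤ n := by exact_mod_cast hn
    have hlog : 0 < Real.log n := Real.log_pos (by linarith)
    obtain ⟨hpos, hlo, hhi⟩ := hdict n (by omega)
    have hle : Real.log c + Real.log (diagArm n) ≤ Real.log (wallPassage n) := by
      rw [← Real.log_mul hc.ne' hpos.ne']
      exact Real.log_le_log (mul_pos hc hpos) hlo
    rw [← sub_div]
    exact div_le_div_of_nonneg_right (by linarith) hlog.le

/-! ## The composition (kernel-checked, no `sorry` of its own) -/

/-- **`HalfPlaneOneArmThird` from the six stubs.** (S)+(IP)+(HF): `P_b(2n+1) = Re R(n)`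
(`wallPassage_eq_re_energyResponse`); (E): `log P_b(2n+1)/log n → −1/3` (`tendsto_log_wallPassage`);
(D): `log diagArm n / log n → −1/3` (`tendsto_log_diagArm`); (O): subtract the orientation defect, which
tends to `0`; the crux is `Negative.ExponentAt half (1/3)` on the nose (`Negative.crux_iff`, `Iff.rfl`). -/
theorem HalfPlaneOneArmThird_of : Theses.CardyBoundaryCoulombGas.HalfPlaneOneArmThird := by
  refine Negative.crux_iff.mpr ?_
  show Tendsto (fun n : ℕ ↦ Real.log (Negative.prob half n) / Real.log n) atTop (𝓝 (-(1 / 3 : ℝ)))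
  have h := tendsto_log_diagArm.sub stub_orientationTransfer
  rw [sub_zero] at h
  refine h.congr' (Eventually.of_forall fun n => ?_)
  rw [← sub_div, sub_sub_cancel, axisArm_eq_prob]

end Summit.CriticalPhenomena.CardyFormulaZ2.Cruxes.HalfPlaneOneArmThird.BoundaryFieldResponse

end
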